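import Summits.ABC.ABC.Theorems.TowerFourSubLiouville.Negative.ConstantFree

/-!
# `TowerFourSubLiouville` (stmt-ABC-1649): coprimality is DISPENSABLE — the crux implies its own non-coprime form

Negative-side load-bearing analysis (standing disprover, cycle 6, refuter-cdisprove-stmt-ABC-1649-g6-0).  Cycles 1–2
showed: WITHOUT `Nat.Coprime a b` the level-4 dial cannot go below `4/3` (`towerIneq4NoCoprime_false_below_four_thirds`,
family `2^{4k} + 2^{4k} = 2·2^{4k}`) and, under `ABC`, it is exactly `4/3` (`Negative.NoCoprimeSharp`).  This file removes
`ABC`: `towerIneq4NoCoprime_of_towerFourSubLiouville` — **`TowerFourSubLiouville ⟹ ∃ A < 2, TowerIneq(4, A)` for ALL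
positive points, coprime or not.**  The converse being trivial, the crux is EQUIVALENT to its non-coprime form: the
hypothesis `Nat.Coprime a b` may be deleted without changing the truth value (it moves the floor of the dial from `1` to
`4/3`, not the threshold-`2` question).  For the disprover a NON-coprime family of tower quality `→ 2` would be a
legitimate kill (none in sight: non-coprime families reach `4/3` trivially and, under `ABC`, nothing more).
Mechanism (`bad_point_bounded_of_le`): by `Negative.Framing.bad_point_shape` a point with `Π^s ≤ c`, `s = 2 − δ`, has
`a·E ≤ 2c^κ` (`a` the smaller summand, `E` the excess, `κ = 4/s − 2`), so `g = gcd(a,b) ≤ a` is tiny; dividing it out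
KEEPS the binomial-quartic shape (`div_quartic_shape`: `g ∣ gcd(vY⁴, vg⁴) = v·gcd(Y,g)⁴`, so `vY⁴ = g·(v'Y'⁴)` with
`v' ≤ vg³`, `Y' ≤ Y`; `reduce_to_coprime`); the reduced COPRIME point has cost `≤ (aE)^{13}·Π` and `c' ≥ c/(aE)`, and the
constant-free crux (`towerFourSubLiouville_constantFree`, exponent `t = max(A₀,1)`) gives `c < 2^{27}c^{27κ}Π^t`, i.e.
`Π^{s(1−27κ)−t} < 2^{27}` with `s(1−27κ) − t = (2−t)/2` for `δ = (2−t)/110`: `Π < 2^{54/(2−t)}` on bad points, where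
also `c < Π²` (`towerPoint_lt_towerProd_sq`).  No `sorry`; axioms standard; imports `Negative.ConstantFree`.
-/

-- `Summit.ABC.ABC` is the mandated summit-side namespace (CONVENTIONS §2); the duplicate is deliberate.
set_option linter.dupNamespace false

namespace Summit.ABC.ABC.Theorems.TowerFourSubLiouville.Negative

open scoped BigOperators
open Summit.ABC.ABC.Theses.IneffectiveSubspace

/-! ## Dividing a common factor out of `v · Y⁴` without losing the quartic shape -/

/-- If `g ∣ v·Y⁴` (`g > 0`) then, with `d = gcd(Y, g)` and `Y = Y'·d`, one has `g ∣ v·d⁴`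
(`g ∣ gcd(vY⁴, vg⁴) = v·gcd(Y,g)⁴`), so `v·Y⁴ = g · (v'·Y'⁴)` with `v' = v d⁴/g ≤ v·g³` and `Y' ≤ Y`. -/
theorem div_quartic_shape {v Y g : ℕ} (hv : 0 < v) (hY : 0 < Y) (hg : 0 < g) (hdvd : g ∣ v * Y ^ 4) :
    ∃ v' Y' : ℕ, 0 < v' ∧ 0 < Y' ∧ v * Y ^ 4 = g * (v' * Y' ^ 4) ∧ v' ≤ v * g ^ 3 ∧ Y' ≤ Y := by
  set d := Nat.gcd Y g with hd
  have hd0 : 0 < d := Nat.gcd_pos_of_pos_right _ hg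
  have hdY : d ∣ Y := Nat.gcd_dvd_left Y g
  have hdg : d ∣ g := Nat.gcd_dvd_right Y g
  obtain ⟨Y', hY'⟩ := hdY
  -- `g ∣ v d⁴`
  have hkey : g ∣ v * d ^ 4 := by
    have h1 : g ∣ Nat.gcd (v * Y ^ 4) (v * g ^ 4) := Nat.dvd_gcd hdvd ⟨v * g ^ 3, by ring⟩
    rwa [Nat.gcd_mul_left, Nat.pow_gcd_pow] at h1
  obtain ⟨v', hv'⟩ := hkey
  have hY'0 : 0 < Y' := by
    rcases Nat.eq_zero_or_pos Y' with h0 | h0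
    · rw [h0, mul_zero] at hY'; omega
    · exact h0
  have hv'0 : 0 < v' := by
    rcases Nat.eq_zero_or_pos v' with h0 | h0
    · rw [h0, mul_zero] at hv'
      have : 0 < v * d ^ 4 := by positivity
      omega
    · exact h0
  refine ⟨v', Y', hv'0, hY'0, ?_, ?_, ?_⟩
  · -- `v Y⁴ = v (Y' d)⁴ = (v d⁴) Y'⁴ = g v' Y'⁴`
    rw [hY']
    calc v * (d * Y') ^ 4 = (v * d ^ 4) * Y' ^ 4 := by ring
      _ = (g * v') * Y' ^ 4 := by rw [hv']
      _ = g * (v' * Y' ^ 4) := by ring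
  · -- `v' g = v d⁴ ≤ v g⁴`
    have hdle : d ≤ g := Nat.le_of_dvd hg hdg
    have h1 : v' * g ≤ (v * g ^ 3) * g := by
      calc v' * g = v * d ^ 4 := by rw [hv']; ring
        _ ≤ v * g ^ 4 := Nat.mul_le_mul_left _ (Nat.pow_le_pow_left hdle 4)
        _ = (v * g ^ 3) * g := by ring
    exact Nat.le_of_mul_le_mul_right h1 hg
  · -- `Y' ≤ Y`
    rw [hY']
    exact Nat.le_mul_of_pos_left Y' hd0

/-- **The reduction.**  A positive solution of `a + v·Y⁴ = w·Z⁴` (not necessarily coprime) yields, after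
division by `g = gcd(a, vY⁴) ≤ a`, a COPRIME positive solution `a' + v'·Y'⁴ = w'·Z'⁴` of the same shape with
`a = g·a'`, `w·Z⁴ = g·(w'·Z'⁴)`, `a' ≤ a`, `v' ≤ v·g³`, `w' ≤ w·g³`, `Y' ≤ Y`, `Z' ≤ Z`. -/
theorem reduce_to_coprime {a v w Y Z : ℕ} (ha : 0 < a) (hv : 0 < v) (hw : 0 < w) (hY : 0 < Y) (hZ : 0 < Z)
    (heq : a + v * Y ^ 4 = w * Z ^ 4) :
    ∃ g a' v' w' Y' Z' : ℕ, 0 < g ∧ 0 < a' ∧ 0 < v' ∧ 0 < w' ∧ 0 < Y' ∧ 0 < Z' ∧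
      a = g * a' ∧ w * Z ^ 4 = g * (w' * Z' ^ 4) ∧ a' + v' * Y' ^ 4 = w' * Z' ^ 4 ∧
      Nat.Coprime a' (v' * Y' ^ 4) ∧ g ≤ a ∧ a' ≤ a ∧ v' ≤ v * g ^ 3 ∧ w' ≤ w * g ^ 3 ∧ Y' ≤ Y ∧ Z' ≤ Z := by
  set g := Nat.gcd a (v * Y ^ 4) with hg
  have hg0 : 0 < g := Nat.gcd_pos_of_pos_left _ ha
  have hga : g ∣ a := Nat.gcd_dvd_left _ _
  have hgb : g ∣ v * Y ^ 4 := Nat.gcd_dvd_right _ _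
  have hgc : g ∣ w * Z ^ 4 := by rw [← heq]; exact dvd_add hga hgb
  obtain ⟨a', ha'⟩ := hga
  obtain ⟨v', Y', hv'0, hY'0, hb, hv'le, hY'le⟩ := div_quartic_shape hv hY hg0 hgb
  obtain ⟨w', Z', hw'0, hZ'0, hc, hw'le, hZ'le⟩ := div_quartic_shape hw hZ hg0 hgc
  have ha'0 : 0 < a' := by
    rcases Nat.eq_zero_or_pos a' with h0 | h0
    · rw [h0, mul_zero] at ha'; omega
    · exact h0
  have heq' : a' + v' * Y' ^ 4 = w' * Z' ^ 4 := by
    have h1 : g * (a' + v' * Y' ^ 4) = g * (w' * Z' ^ 4) := by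
      rw [mul_add, ← ha', ← hb, ← hc, heq]
    exact Nat.eq_of_mul_eq_mul_left hg0 h1
  have hcop : Nat.Coprime a' (v' * Y' ^ 4) := by
    have h1 := Nat.coprime_div_gcd_div_gcd (m := a) (n := v * Y ^ 4) hg0
    rw [← hg] at h1
    have h2 : a / g = a' := by
      rw [ha']; exact Nat.mul_div_cancel_left a' hg0
    have h3 : v * Y ^ 4 / g = v' * Y' ^ 4 := by
      rw [hb]; exact Nat.mul_div_cancel_left _ hg0
    rwa [h2, h3] at h1
  have hgle : g ≤ a := Nat.le_of_dvd ha ⟨a', ha'⟩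
  have ha'le : a' ≤ a := by
    rw [ha']; exact Nat.le_mul_of_pos_left a' hg0
  exact ⟨g, a', v', w', Y', Z', hg0, ha'0, hv'0, hw'0, hY'0, hZ'0, ha', hc, heq', hcop, hgle, ha'le,
    hv'le, hw'le, hY'le, hZ'le⟩

/-! ## Coordinates of a tower point: `b = v·Y⁴`, `c = w·Z⁴`, and the size bookkeeping -/

/-- `y₀y₁²y₂³ ≤ E³` where `E = (x₀y₀z₀)³(x₁y₁z₁)²(x₂y₂z₂)` (all coordinates positive). -/
theorem cofactor_le_cube (x y z : Fin 4 → ℕ) (hpos : ∀ i, 0 < x i ∧ 0 < y i ∧ 0 < z i) :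
    y 0 * y 1 ^ 2 * y 2 ^ 3 ≤ ((x 0 * y 0 * z 0) ^ 3 * (x 1 * y 1 * z 1) ^ 2 * (x 2 * y 2 * z 2)) ^ 3 := by
  obtain ⟨hx0, hy0, hz0⟩ := hpos 0
  obtain ⟨hx1, hy1, hz1⟩ := hpos 1
  obtain ⟨hx2, hy2, hz2⟩ := hpos 2
  set E := (x 0 * y 0 * z 0) ^ 3 * (x 1 * y 1 * z 1) ^ 2 * (x 2 * y 2 * z 2) with hE
  -- `y₀ y₁ y₂ ≤ E`
  have h0 : y 0 ≤ (x 0 * y 0 * z 0) ^ 3 := by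
    calc y 0 ≤ x 0 * y 0 * z 0 := by
          calc y 0 = 1 * y 0 * 1 := by ring
            _ ≤ x 0 * y 0 * z 0 := Nat.mul_le_mul (Nat.mul_le_mul hx0 le_rfl) hz0
      _ ≤ (x 0 * y 0 * z 0) ^ 3 := Nat.le_self_pow (by norm_num) _
  have h1 : y 1 ≤ (x 1 * y 1 * z 1) ^ 2 := by
    calc y 1 ≤ x 1 * y 1 * z 1 := by
          calc y 1 = 1 * y 1 * 1 := by ring
            _ ≤ x 1 * y 1 * z 1 := Nat.mul_le_mul (Nat.mul_le_mul hx1 le_rfl) hz1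
      _ ≤ (x 1 * y 1 * z 1) ^ 2 := Nat.le_self_pow (by norm_num) _
  have h2 : y 2 ≤ x 2 * y 2 * z 2 := by
    calc y 2 = 1 * y 2 * 1 := by ring
      _ ≤ x 2 * y 2 * z 2 := Nat.mul_le_mul (Nat.mul_le_mul hx2 le_rfl) hz2
  have hyE : y 0 * y 1 * y 2 ≤ E := Nat.mul_le_mul (Nat.mul_le_mul h0 h1) h2
  -- `y₀ y₁² y₂³ ≤ (y₀ y₁ y₂)³ ≤ E³`
  calc y 0 * y 1 ^ 2 * y 2 ^ 3 ≤ y 0 ^ 3 * y 1 ^ 3 * y 2 ^ 3 :=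
        Nat.mul_le_mul (Nat.mul_le_mul (Nat.le_self_pow (by norm_num) _)
          (Nat.pow_le_pow_right hy1 (by norm_num))) le_rfl
    _ = (y 0 * y 1 * y 2) ^ 3 := by ring
    _ ≤ E ^ 3 := Nat.pow_le_pow_left hyE 3

/-- **Bad non-coprime points reduce to bad coprime points (quantitative).**  Let `1 ≤ t < 2` and suppose EVERY
positive coprime level-4 point has `c < Π^t` (the constant-free crux).  Put `δ = (2 − t)/110`, `s = 2 − δ`.  Then
every positive level-4 point (coprime or not) with `x`-summand `a ≤ b` and `Π^s ≤ c` has `Π < 2^{54/(2−t)}`.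
Proof: `bad_point_shape` gives `a·E ≤ 2c^κ`, `κ = 4/s − 2`; dividing `g = gcd(a,b) ≤ a` out (`reduce_to_coprime`)
gives a coprime point of cost `Π' ≤ (aE)^{13}·Π` with `c' = c/g ≥ c/(aE)`; so `c < (aE)^{27} Π^t ≤ 2^{27} c^{27κ} Π^t`,
and with `Π^s ≤ c`: `Π^{s(1−27κ) − t} < 2^{27}`, where `s(1 − 27κ) − t = (2 − t)/2` exactly. -/
theorem bad_point_bounded_of_le {t : ℝ} (ht1 : 1 ≤ t) (ht2 : t < 2)
    (hcf : ∀ x y z : Fin 4 → ℕ, (∀ i, 0 < x i ∧ 0 < y i ∧ 0 < z i) →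
      (∏ i, x i ^ (i.val + 1)) + (∏ i, y i ^ (i.val + 1)) = ∏ i, z i ^ (i.val + 1) →
      Nat.Coprime (∏ i, x i ^ (i.val + 1)) (∏ i, y i ^ (i.val + 1)) →
      ((∏ i, z i ^ (i.val + 1) : ℕ) : ℝ) < ((∏ i, x i * y i * z i : ℕ) : ℝ) ^ t)
    (x y z : Fin 4 → ℕ) (hpos : ∀ i, 0 < x i ∧ 0 < y i ∧ 0 < z i)
    (heq : (∏ i, x i ^ (i.val + 1)) + (∏ i, y i ^ (i.val + 1)) = ∏ i, z i ^ (i.val + 1))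
    (hab : (∏ i, x i ^ (i.val + 1)) ≤ (∏ i, y i ^ (i.val + 1)))
    (hbad : ((∏ i, x i * y i * z i : ℕ) : ℝ) ^ (2 - (2 - t) / 110) ≤ ((∏ i, z i ^ (i.val + 1) : ℕ) : ℝ)) :
    ((∏ i, x i * y i * z i : ℕ) : ℝ) < (2 : ℝ) ^ (54 / (2 - t)) := by
  set δ : ℝ := (2 - t) / 110 with hδ
  set s : ℝ := 2 - δ with hs
  have hδ0 : 0 < δ := by rw [hδ]; linarith
  have hδ1 : δ ≤ 1 / 110 := by rw [hδ]; linarith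
  have hs1 : 1 ≤ s := by rw [hs]; linarith
  have hs0 : 0 < s := by linarith
  set κ : ℝ := 4 / s - 2 with hκ
  have hsκ : s * κ = 2 * δ := by
    have h1 : s * κ = 4 - 2 * s := by rw [hκ]; field_simp
    rw [h1, hs]; ring
  have hκ0 : 0 ≤ κ := by
    have : 0 ≤ s * κ := by rw [hsκ]; linarith
    nlinarith
  have hκle : κ ≤ 2 * δ := by
    nlinarith [hsκ, hκ0]
  set u : ℝ := 1 - 27 * κ with hu
  have hu0 : 0 < u := by rw [hu]; nlinarith
  set γ : ℝ := (2 - t) / 2 with hγ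
  have hγ0 : 0 < γ := by rw [hγ]; linarith
  have hsuγ : s * u = γ + t := by
    rw [hu, hγ, mul_sub, show s * (27 * κ) = 27 * (s * κ) by ring, hsκ, hs, hδ]; ring
  have hE3y := cofactor_le_cube x y z hpos
  have hE3z := cofactor_le_cube x z y (fun i => ⟨(hpos i).1, (hpos i).2.2, (hpos i).2.1⟩)
  have hshape := bad_point_shape (C := 1) (s := s) one_pos hs0 x y z hpos heq (by rw [one_mul]; exact hbad)
  rw [min_eq_left hab, div_one] at hshape
  have hbv : (∏ i, y i ^ (i.val + 1)) = (y 0 * y 1 ^ 2 * y 2 ^ 3) * y 3 ^ 4 := by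
    rw [prod_pow_succ_four]
  have hcw : (∏ i, z i ^ (i.val + 1)) = (z 0 * z 1 ^ 2 * z 2 ^ 3) * z 3 ^ 4 := by
    rw [prod_pow_succ_four]
  have hPexp : (∏ i, x i * y i * z i) =
      (x 0 * y 0 * z 0) * (x 1 * y 1 * z 1) * (x 2 * y 2 * z 2) * (x 3 * y 3 * z 3) := prod_mul_four x y z
  have hEz : (x 0 * z 0 * y 0) ^ 3 * (x 1 * z 1 * y 1) ^ 2 * (x 2 * z 2 * y 2) =
      (x 0 * y 0 * z 0) ^ 3 * (x 1 * y 1 * z 1) ^ 2 * (x 2 * y 2 * z 2) := by ring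
  rw [hEz] at hE3z
  obtain ⟨hx0, hy0, hz0⟩ := hpos 0
  obtain ⟨hx1, hy1, hz1⟩ := hpos 1
  obtain ⟨hx2, hy2, hz2⟩ := hpos 2
  obtain ⟨hx3, hy3, hz3⟩ := hpos 3
  generalize hv : y 0 * y 1 ^ 2 * y 2 ^ 3 = v at hbv hE3y
  generalize hw : z 0 * z 1 ^ 2 * z 2 ^ 3 = w at hcw hE3z
  generalize hY : y 3 = Y at hbv hPexp hy3
  generalize hZ : z 3 = Z at hcw hPexp hz3
  generalize hE : (x 0 * y 0 * z 0) ^ 3 * (x 1 * y 1 * z 1) ^ 2 * (x 2 * y 2 * z 2) = E at hshape hE3y hE3z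
  generalize ha : (∏ i, x i ^ (i.val + 1)) = a at heq hab hshape
  rw [hbv] at heq hab
  rw [hcw] at heq hshape hbad
  generalize hP : (∏ i, x i * y i * z i) = P at hshape hbad hPexp ⊢
  have ha0 : 0 < a := by rw [← ha]; exact Finset.prod_pos fun i _ => pow_pos (hpos i).1 _
  have hv0 : 0 < v := by rw [← hv]; positivity
  have hw0 : 0 < w := by rw [← hw]; positivity
  have hE0 : 0 < E := by rw [← hE]; positivity
  have hYZP : Y * Z ≤ P := by
    rw [hPexp]
    have h1 : 1 ≤ (x 0 * y 0 * z 0) * (x 1 * y 1 * z 1) * (x 2 * y 2 * z 2) := by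
      have : 0 < (x 0 * y 0 * z 0) * (x 1 * y 1 * z 1) * (x 2 * y 2 * z 2) := by positivity
      omega
    calc Y * Z = 1 * (1 * Y * Z) := by ring
      _ ≤ ((x 0 * y 0 * z 0) * (x 1 * y 1 * z 1) * (x 2 * y 2 * z 2)) * (x 3 * Y * Z) :=
          Nat.mul_le_mul h1 (Nat.mul_le_mul (Nat.mul_le_mul hx3 le_rfl) le_rfl)
  obtain ⟨g, a', v', w', Y', Z', hg0, ha'0, hv'0, hw'0, hY'0, hZ'0, hga, hgc, heq', hcop, hga_le, ha'le,
    hv'le, hw'le, hY'le, hZ'le⟩ := reduce_to_coprime ha0 hv0 hw0 hy3 hz3 heq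
  have hlt := hcf ![a', 1, 1, 1] ![v', 1, 1, Y'] ![w', 1, 1, Z']
    (by intro i; fin_cases i <;> simp [ha'0, hv'0, hw'0, hY'0, hZ'0])
    (by rw [prod_pow_succ_four, prod_pow_succ_four, prod_pow_succ_four]; simpa using heq')
    (by rw [prod_pow_succ_four, prod_pow_succ_four]; simpa using hcop)
  have hc' : (∏ i, (![w', 1, 1, Z'] : Fin 4 → ℕ) i ^ (i.val + 1)) = w' * Z' ^ 4 := by
    rw [prod_pow_succ_four]; simp
  have hP' : (∏ i, (![a', 1, 1, 1] : Fin 4 → ℕ) i * (![v', 1, 1, Y'] : Fin 4 → ℕ) i *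
      (![w', 1, 1, Z'] : Fin 4 → ℕ) i) = a' * v' * w' * (Y' * Z') := by
    rw [prod_mul_four]; simp
  rw [hc', hP'] at hlt
  set S : ℕ := a * E with hSdef
  have hS1 : 1 ≤ S := Nat.mul_pos ha0 hE0
  have hES : E ≤ S := Nat.le_mul_of_pos_left E ha0
  have haS : a ≤ S := Nat.le_mul_of_pos_right a hE0
  have hgS : g ≤ S := hga_le.trans haS
  have hv'S : v' ≤ S ^ 6 := by
    calc v' ≤ v * g ^ 3 := hv'le
      _ ≤ E ^ 3 * S ^ 3 := Nat.mul_le_mul hE3y (Nat.pow_le_pow_left hgS 3)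
      _ ≤ S ^ 3 * S ^ 3 := Nat.mul_le_mul_right _ (Nat.pow_le_pow_left hES 3)
      _ = S ^ 6 := by ring
  have hw'S : w' ≤ S ^ 6 := by
    calc w' ≤ w * g ^ 3 := hw'le
      _ ≤ E ^ 3 * S ^ 3 := Nat.mul_le_mul hE3z (Nat.pow_le_pow_left hgS 3)
      _ ≤ S ^ 3 * S ^ 3 := Nat.mul_le_mul_right _ (Nat.pow_le_pow_left hES 3)
      _ = S ^ 6 := by ring
  have hP'le : a' * v' * w' * (Y' * Z') ≤ S ^ 13 * P := by
    calc a' * v' * w' * (Y' * Z') ≤ S * S ^ 6 * S ^ 6 * (Y * Z) :=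
          Nat.mul_le_mul (Nat.mul_le_mul (Nat.mul_le_mul (ha'le.trans haS) hv'S) hw'S)
            (Nat.mul_le_mul hY'le hZ'le)
      _ ≤ S * S ^ 6 * S ^ 6 * P := Nat.mul_le_mul_left _ hYZP
      _ = S ^ 13 * P := by ring
  have hSR1 : (1 : ℝ) ≤ S := by exact_mod_cast hS1
  have hSR0 : (0 : ℝ) < S := by linarith
  have hPR1 : (1 : ℝ) ≤ P := by
    have : 1 ≤ P := le_trans (Nat.mul_pos hy3 hz3) hYZP
    exact_mod_cast this
  have hPR0 : (0 : ℝ) < P := by linarith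
  have hcR0 : (0 : ℝ) < ((w * Z ^ 4 : ℕ) : ℝ) := by
    have : 0 < w * Z ^ 4 := by positivity
    exact_mod_cast this
  have ht0 : 0 ≤ t := by linarith
  -- (1) `c' < (S^13 P)^t ≤ S^26 P^t`
  have h1 : ((w' * Z' ^ 4 : ℕ) : ℝ) < (S : ℝ) ^ 26 * (P : ℝ) ^ t := by
    have hP'R : ((a' * v' * w' * (Y' * Z') : ℕ) : ℝ) ≤ ((S ^ 13 * P : ℕ) : ℝ) := by exact_mod_cast hP'le
    calc ((w' * Z' ^ 4 : ℕ) : ℝ) < ((a' * v' * w' * (Y' * Z') : ℕ) : ℝ) ^ t := hlt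
      _ ≤ ((S ^ 13 * P : ℕ) : ℝ) ^ t := Real.rpow_le_rpow (by positivity) hP'R ht0
      _ = ((S : ℝ) ^ 13) ^ t * (P : ℝ) ^ t := by
          push_cast; exact Real.mul_rpow (by positivity) (by positivity)
      _ ≤ ((S : ℝ) ^ 13) ^ (2 : ℝ) * (P : ℝ) ^ t :=
          mul_le_mul_of_nonneg_right (Real.rpow_le_rpow_of_exponent_le (one_le_pow₀ hSR1) ht2.le)
            (Real.rpow_nonneg hPR0.le _)
      _ = (S : ℝ) ^ 26 * (P : ℝ) ^ t := by
          congr 1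
          rw [show (2 : ℝ) = ((2 : ℕ) : ℝ) by norm_num, Real.rpow_natCast]; ring
  -- (2) `c = g c' ≤ S c' < S^27 P^t`
  have h2 : ((w * Z ^ 4 : ℕ) : ℝ) < (S : ℝ) ^ 27 * (P : ℝ) ^ t := by
    have hcg : ((w * Z ^ 4 : ℕ) : ℝ) = (g : ℝ) * ((w' * Z' ^ 4 : ℕ) : ℝ) := by exact_mod_cast hgc
    have hgR : (g : ℝ) ≤ S := by exact_mod_cast hgS
    have hc'0 : (0 : ℝ) ≤ ((w' * Z' ^ 4 : ℕ) : ℝ) := by positivity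
    calc ((w * Z ^ 4 : ℕ) : ℝ) = (g : ℝ) * ((w' * Z' ^ 4 : ℕ) : ℝ) := hcg
      _ ≤ (S : ℝ) * ((w' * Z' ^ 4 : ℕ) : ℝ) := mul_le_mul_of_nonneg_right hgR hc'0
      _ < (S : ℝ) * ((S : ℝ) ^ 26 * (P : ℝ) ^ t) := mul_lt_mul_of_pos_left h1 hSR0
      _ = (S : ℝ) ^ 27 * (P : ℝ) ^ t := by ring
  -- (3) `S ≤ 2 c^κ`, so `S^27 ≤ 2^27 c^{27κ}`
  set cR : ℝ := ((w * Z ^ 4 : ℕ) : ℝ) with hcRdef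
  have h3 : (S : ℝ) ≤ 2 * cR ^ κ := by
    -- hshape : a * E * c² ≤ 2 * c^{4/s}, and `c^{4/s} = c^κ * c^2`
    have hsplit : cR ^ (4 / s) = cR ^ κ * cR ^ 2 := by
      rw [show (4 : ℝ) / s = κ + 2 by rw [hκ]; ring, Real.rpow_add hcR0,
        show (2 : ℝ) = ((2 : ℕ) : ℝ) by norm_num, Real.rpow_natCast]
    have hS : ((S : ℕ) : ℝ) = (a : ℝ) * E := by rw [hSdef]; push_cast; ring
    have h' : ((S : ℕ) : ℝ) * cR ^ 2 ≤ (2 * cR ^ κ) * cR ^ 2 := by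
      rw [hS, mul_assoc 2, ← hsplit]; exact hshape
    exact le_of_mul_le_mul_right h' (by positivity)
  have h3' : (S : ℝ) ^ 27 ≤ (2 : ℝ) ^ 27 * cR ^ (27 * κ) := by
    calc (S : ℝ) ^ 27 ≤ (2 * cR ^ κ) ^ 27 := pow_le_pow_left₀ hSR0.le h3 27
      _ = (2 : ℝ) ^ 27 * (cR ^ κ) ^ 27 := mul_pow _ _ _
      _ = (2 : ℝ) ^ 27 * cR ^ (27 * κ) := by
          congr 1
          rw [← Real.rpow_natCast, ← Real.rpow_mul hcR0.le]; push_cast; ring_nf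
  -- (4) `c^u < 2^27 P^t` where `u = 1 − 27κ`
  have h4 : cR ^ u < (2 : ℝ) ^ 27 * (P : ℝ) ^ t := by
    have hck : 0 < cR ^ (27 * κ) := Real.rpow_pos_of_pos hcR0 _
    have hsplit : cR = cR ^ u * cR ^ (27 * κ) := by
      rw [← Real.rpow_add hcR0, show u + 27 * κ = 1 by rw [hu]; ring, Real.rpow_one]
    have h' : cR ^ u * cR ^ (27 * κ) < ((2 : ℝ) ^ 27 * (P : ℝ) ^ t) * cR ^ (27 * κ) := by
      calc cR ^ u * cR ^ (27 * κ) = cR := hsplit.symm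
        _ < (S : ℝ) ^ 27 * (P : ℝ) ^ t := h2
        _ ≤ ((2 : ℝ) ^ 27 * cR ^ (27 * κ)) * (P : ℝ) ^ t :=
            mul_le_mul_of_nonneg_right h3' (Real.rpow_nonneg hPR0.le _)
        _ = ((2 : ℝ) ^ 27 * (P : ℝ) ^ t) * cR ^ (27 * κ) := by ring
    exact lt_of_mul_lt_mul_right h' hck.le
  -- (5) `P^{s u} ≤ c^u`, and `P^{su} = P^γ P^t`
  have h5 : (P : ℝ) ^ γ * (P : ℝ) ^ t < (2 : ℝ) ^ 27 * (P : ℝ) ^ t := by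
    have h' : ((P : ℝ) ^ s) ^ u ≤ cR ^ u := Real.rpow_le_rpow (Real.rpow_nonneg hPR0.le _) hbad hu0.le
    rw [← Real.rpow_mul hPR0.le, hsuγ, Real.rpow_add hPR0] at h'
    exact lt_of_le_of_lt h' h4
  have h6 : (P : ℝ) ^ γ < (2 : ℝ) ^ 27 := lt_of_mul_lt_mul_right h5 (Real.rpow_nonneg hPR0.le _)
  -- (6) `P < (2^27)^{1/γ} = 2^{54/(2−t)}`
  have h7 : ((P : ℝ) ^ γ) ^ (1 / γ) < ((2 : ℝ) ^ 27) ^ (1 / γ) :=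
    Real.rpow_lt_rpow (Real.rpow_nonneg hPR0.le _) h6 (by positivity)
  rw [← Real.rpow_mul hPR0.le, mul_one_div_cancel hγ0.ne', Real.rpow_one] at h7
  calc (P : ℝ) < ((2 : ℝ) ^ 27) ^ (1 / γ) := h7
    _ = (2 : ℝ) ^ (54 / (2 - t)) := by
        rw [show ((2 : ℝ) ^ 27) = (2 : ℝ) ^ ((27 : ℕ) : ℝ) from (Real.rpow_natCast 2 27).symm,
          ← Real.rpow_mul (by norm_num)]
        congr 1
        rw [hγ]; push_cast; field_simp; ring

/-- **Coprimality is dispensable: the crux implies its own non-coprime form.**  If `TowerFourSubLiouville`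
holds then for some `A < 2` the level-4 tower inequality `c < C(ε)·Π^{A+ε}` holds for ALL positive points
`a + b = c`, coprime or not (the converse implication is trivial).  So the hypothesis `Nat.Coprime a b` can be
deleted from the crux without changing its truth value — it changes the VALUE of the dial (floor `4/3` without
coprimality, `towerIneq4NoCoprime_false_below_four_thirds`, versus `1` with it), not the threshold-`2` question.
Unconditional upgrade of `Negative.Framing.towerIneq4NoCoprime_of_abc` / `Negative.NoCoprimeSharp` (which needed
`ABC`).  Proof: `bad_point_bounded_of_le` (after the symmetry `a ↔ b`) bounds `Π` on the points with `Π^s ≤ c`,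
`s = 2 − (2 − t)/110`, `t = max(A₀, 1)` from the constant-free crux; there `c < Π² < B²`; elsewhere `c < Π^s`. -/
theorem towerIneq4NoCoprime_of_towerFourSubLiouville (h : TowerFourSubLiouville) :
    ∃ A : ℝ, A < 2 ∧ ∀ ε : ℝ, 0 < ε → ∃ C : ℝ, 0 < C ∧ ∀ x y z : Fin 4 → ℕ,
      (∀ i, 0 < x i ∧ 0 < y i ∧ 0 < z i) →
      (∏ i, x i ^ (i.val + 1)) + (∏ i, y i ^ (i.val + 1)) = ∏ i, z i ^ (i.val + 1) →
      ((∏ i, z i ^ (i.val + 1) : ℕ) : ℝ) < C * ((∏ i, x i * y i * z i : ℕ) : ℝ) ^ (A + ε) := by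
  obtain ⟨A₀, hA₀, hcf₀⟩ := towerFourSubLiouville_constantFree h
  set t : ℝ := max A₀ 1 with ht
  have ht1 : 1 ≤ t := le_max_right _ _
  have ht2 : t < 2 := max_lt hA₀ (by norm_num)
  -- the constant-free crux at exponent `t ≥ 1`
  have hcf : ∀ x y z : Fin 4 → ℕ, (∀ i, 0 < x i ∧ 0 < y i ∧ 0 < z i) →
      (∏ i, x i ^ (i.val + 1)) + (∏ i, y i ^ (i.val + 1)) = ∏ i, z i ^ (i.val + 1) →
      Nat.Coprime (∏ i, x i ^ (i.val + 1)) (∏ i, y i ^ (i.val + 1)) →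
      ((∏ i, z i ^ (i.val + 1) : ℕ) : ℝ) < ((∏ i, x i * y i * z i : ℕ) : ℝ) ^ t := by
    intro x y z hpos heq hcop
    have h1 := hcf₀ x y z hpos heq hcop
    have hP1 : (1 : ℝ) ≤ ((∏ i, x i * y i * z i : ℕ) : ℝ) := by
      have h2 := two_le_towerProd x y z hpos heq
      have : (2 : ℝ) ≤ ((∏ i, x i * y i * z i : ℕ) : ℝ) := by exact_mod_cast h2
      linarith
    exact lt_of_lt_of_le h1 (Real.rpow_le_rpow_of_exponent_le hP1 (le_max_left _ _))
  set s : ℝ := 2 - (2 - t) / 110 with hs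
  have hs0 : 0 < s := by rw [hs]; linarith
  set B : ℝ := (2 : ℝ) ^ (54 / (2 - t)) with hB
  have hB0 : 0 < B := Real.rpow_pos_of_pos (by norm_num) _
  refine ⟨s, by rw [hs]; linarith, fun ε hε => ⟨B ^ 2 + 1, by positivity, fun x y z hpos heq => ?_⟩⟩
  have hP2 := two_le_towerProd x y z hpos heq
  have hlt2 := towerPoint_lt_towerProd_sq x y z hpos heq
  have hPR1 : (1 : ℝ) ≤ ((∏ i, x i * y i * z i : ℕ) : ℝ) := by
    have : (2 : ℝ) ≤ ((∏ i, x i * y i * z i : ℕ) : ℝ) := by exact_mod_cast hP2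
    linarith
  have hpow1 : (1 : ℝ) ≤ ((∏ i, x i * y i * z i : ℕ) : ℝ) ^ (s + ε) := Real.one_le_rpow hPR1 (by linarith)
  by_cases hbad : ((∏ i, x i * y i * z i : ℕ) : ℝ) ^ s ≤ ((∏ i, z i ^ (i.val + 1) : ℕ) : ℝ)
  · -- bad point: `Π < B` (WLOG `a ≤ b` by the symmetry `x ↔ y`), so `c < Π² < B²`
    have hPB : ((∏ i, x i * y i * z i : ℕ) : ℝ) < B := by
      rcases le_total (∏ i, x i ^ (i.val + 1)) (∏ i, y i ^ (i.val + 1)) with hab | hba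
      · exact bad_point_bounded_of_le ht1 ht2 hcf x y z hpos heq hab hbad
      · have heq' : (∏ i, y i ^ (i.val + 1)) + (∏ i, x i ^ (i.val + 1)) = ∏ i, z i ^ (i.val + 1) := by
          omega
        have hperm : (∏ i, y i * x i * z i) = ∏ i, x i * y i * z i :=
          Finset.prod_congr rfl fun i _ => by ring
        have h' := bad_point_bounded_of_le ht1 ht2 hcf y x z
          (fun i => ⟨(hpos i).2.1, (hpos i).1, (hpos i).2.2⟩) heq' hba (by rw [hperm]; exact hbad)
        rwa [hperm] at h'
    have hc2 : ((∏ i, z i ^ (i.val + 1) : ℕ) : ℝ) < ((∏ i, x i * y i * z i : ℕ) : ℝ) ^ 2 := by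
      exact_mod_cast hlt2
    calc ((∏ i, z i ^ (i.val + 1) : ℕ) : ℝ) < ((∏ i, x i * y i * z i : ℕ) : ℝ) ^ 2 := hc2
      _ ≤ B ^ 2 := pow_le_pow_left₀ (by positivity) hPB.le 2
      _ ≤ B ^ 2 + 1 := by linarith
      _ = (B ^ 2 + 1) * 1 := by ring
      _ ≤ (B ^ 2 + 1) * ((∏ i, x i * y i * z i : ℕ) : ℝ) ^ (s + ε) :=
          mul_le_mul_of_nonneg_left hpow1 (by positivity)
  · -- good point: `c < Π^s ≤ Π^{s+ε} ≤ (B²+1) Π^{s+ε}`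
    rw [not_le] at hbad
    calc ((∏ i, z i ^ (i.val + 1) : ℕ) : ℝ) < ((∏ i, x i * y i * z i : ℕ) : ℝ) ^ s := hbad
      _ ≤ ((∏ i, x i * y i * z i : ℕ) : ℝ) ^ (s + ε) :=
          Real.rpow_le_rpow_of_exponent_le hPR1 (by linarith)
      _ = 1 * ((∏ i, x i * y i * z i : ℕ) : ℝ) ^ (s + ε) := by ring
      _ ≤ (B ^ 2 + 1) * ((∏ i, x i * y i * z i : ℕ) : ℝ) ^ (s + ε) :=
          mul_le_mul_of_nonneg_right (by nlinarith [sq_nonneg B]) (by linarith)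

end Summit.ABC.ABC.Theorems.TowerFourSubLiouville.Negative
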